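import Mathlib.Analysis.SpecialFunctions.Trigonometric.Bounds
import Mathlib.Analysis.SpecialFunctions.Log.Basic
import Mathlib.MeasureTheory.Integral.Bochner.Basic
import Mathlib.MeasureTheory.Integral.IntegrableOn
import Mathlib.Dynamics.Ergodic.MeasurePreserving
import HarnessLib

/-!
# The Fröhlich–Spencer lower bound on shifted cosine products (FS82 §2.10, (2.79)–(2.80))

Support file for the Coulomb-gas / sine-Gordon analysis of abelian lattice models at weak
coupling — the proof programme of the named fact
`Literature.MathematicalPhysics.QuantumFieldTheory.FrohlichSpencerU1PerimeterLawD4` (the `U(1)₄`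
perimeter law, Fröhlich–Spencer 1982 §2) and of its corollary
`Literature.Barriers.QuantumFields.AbelianDeconfinementD4`. Everything is PROVED; no named fact
is introduced (D-0026).

After the renormalisation of the 1-ensemble expansion (FS82 Corollary 4, (2.71)), the Wilson loop
expectation is a positive superposition of Gaussian integrals of products
`∏_ρ [1 + z(β,ρ) cos(α(ρ̄) - θ_ρ)]` with activities `0 ≤ z < 1` and phases `θ_ρ = (ε_Λ, μ_ρ)`,
while the normalising partition function carries the same products at `θ = 0`. FS82 §2.10
(p. 431) bounds the former from below by the latter: "We shall make use of the following simple
estimate: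
`1 + z cos(α - θ) = (1 + z cos α)[1 + (z cos α (cos θ - 1) + z sin α sin θ)/(1 + z cos α)]`
`≥ (1 + z cos α) exp[E(α, θ) + O(α, θ) - γ(z) θ²]`, where
`E(α, θ) = (1 + z cos α)⁻¹ z cos α (cos θ - 1)` and `O(α, θ) = (1 + z cos α)⁻¹ z sin α sin θ`.
This inequality follows from Taylor's theorem with remainder, applied to the function
`log(1 + x)`, along with elementary estimates on trigonometric functions. Thus, by Jensen's
inequality, `∫ ∏_ρ [1 + z(β,ρ) cos(α(ρ̄) - θ_ρ)] dμ⁰_Λ ≥ Z¹ exp⟨∑_ρ (E + O - γ θ_ρ²)⟩¹` ((2.79)).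
But `⟨O(α(ρ̄), θ_ρ)⟩¹ = 0`, since `O` is odd in `α`, while `⟨·⟩¹` is even in `α`" — whence the
lower bound `≥ Z¹ exp(-∑_ρ γ'(z) θ_ρ²)` feeding (2.80)–(2.88).

We prove this with explicit constants, absorbing the even part `E ≥ -z θ²/(2(1-z))` into the
`θ²` term, and replacing Jensen's inequality by the pointwise bound `e^y ≥ 1 + y` (which gives the
same first-order conclusion, the odd term integrating to zero):

* `gammaFS z = z/(2(1-z)) + z²(1+z)/(1-z)³` (`≥ 0`, and `≤ 7z` for `z ≤ ½`), `oddPart z a θ = O(a, θ)`;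
* `one_add_mul_cos_sub_ge` (**(2.79), pointwise**): for `0 ≤ z < 1`,
  `(1 + z cos a) · exp(O(a,θ) - γ(z) θ²) ≤ 1 + z cos(a - θ)`;
* `prod_one_add_mul_cos_sub_ge`, `prod_one_add_mul_cos_sub_ge_linear` (products over a finite
  family, and the linearised form `e^{-∑γθ²} (∏ (1 + z cos aᵢ)) (1 + ∑ Oᵢ) ≤ ∏ (1 + z cos(aᵢ - θᵢ))`);
* `exp_mul_integral_prod_le` (**the integrated bound, (2.79)–(2.80)**): for a finite measure `μ`
  invariant under a measurable involution `neg` with `aᵢ ∘ neg = -aᵢ` (e.g. a centred Gaussian and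
  linear phases), `e^{-∑ᵢ γ(zᵢ) θᵢ²} ∫ ∏ᵢ (1 + zᵢ cos aᵢ) dμ ≤ ∫ ∏ᵢ (1 + zᵢ cos(aᵢ - θᵢ)) dμ`.

## References

* J. Fröhlich, T. Spencer, *Massless phases and symmetry restoration in abelian gauge theories
  and spin systems*, Comm. Math. Phys. 83 (1982) 411–454, §2.10, (2.78)–(2.80), p. 431.
  [FrohlichSpencerCMP1982]
-/

noncomputable section

open MeasureTheory Finset
open scoped BigOperators

namespace Literature.Probability.LatticeModels

namespace EnsembleExpansion

/-! ### Constants -/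

/-- The constant `γ(z) = z/(2(1-z)) + z²(1+z)/(1-z)³` of the `θ²`-loss in the shifted-cosine
bound (FS82's `γ(z)` with the even part `E` absorbed). [cite: FrohlichSpencerCMP1982, (2.79) p. 431] -/
def gammaFS (z : ℝ) : ℝ := z / (2 * (1 - z)) + z ^ 2 * (1 + z) / (1 - z) ^ 3

/-- `γ(z) ≥ 0` for `0 ≤ z < 1`. [folklore] -/
theorem gammaFS_nonneg {z : ℝ} (hz0 : 0 ≤ z) (hz1 : z < 1) : 0 ≤ gammaFS z := by
  unfold gammaFS
  have h1 : 0 < 1 - z := by linarith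
  positivity

/-- `γ(z) ≤ 7 z` for `0 ≤ z ≤ ½` (so `γ(z(β,ρ)) → 0` with the activities). [folklore] -/
theorem gammaFS_le {z : ℝ} (hz0 : 0 ≤ z) (hz : z ≤ 1 / 2) : gammaFS z ≤ 7 * z := by
  unfold gammaFS
  have h1 : 1 / 2 ≤ 1 - z := by linarith
  have hA : z / (2 * (1 - z)) ≤ z := by
    rw [div_le_iff₀ (by linarith)]
    nlinarith
  have hB : z ^ 2 * (1 + z) / (1 - z) ^ 3 ≤ 6 * z := by
    rw [div_le_iff₀ (by positivity)]
    have h3 : (1 / 2 : ℝ) ^ 3 ≤ (1 - z) ^ 3 := pow_le_pow_left₀ (by norm_num) h1 3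
    nlinarith [mul_nonneg hz0 hz0, mul_nonneg (mul_nonneg hz0 hz0) hz0]
  linarith

/-- The odd part `O(a, θ) = z sin a sin θ / (1 + z cos a)` of FS82 (2.79).
[cite: FrohlichSpencerCMP1982, (2.79) p. 431] -/
def oddPart (z a θ : ℝ) : ℝ := z * Real.sin a * Real.sin θ / (1 + z * Real.cos a)

/-- `O` is odd in `a`. [cite: FrohlichSpencerCMP1982, p. 431] -/
theorem oddPart_neg (z a θ : ℝ) : oddPart z (-a) θ = -oddPart z a θ := by
  simp [oddPart, Real.sin_neg, Real.cos_neg, neg_div]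

/-- `|O(a,θ)| ≤ z/(1-z)` for `0 ≤ z < 1`. [folklore] -/
theorem abs_oddPart_le {z : ℝ} (hz0 : 0 ≤ z) (hz1 : z < 1) (a θ : ℝ) :
    |oddPart z a θ| ≤ z / (1 - z) := by
  unfold oddPart
  have hD : 1 - z ≤ 1 + z * Real.cos a := by nlinarith [Real.neg_one_le_cos a]
  have hDpos : 0 < 1 + z * Real.cos a := by linarith
  rw [abs_div, abs_of_pos hDpos, div_le_div_iff₀ hDpos (by linarith)]
  have h1 : |z * Real.sin a * Real.sin θ| ≤ z := by
    rw [abs_mul, abs_mul, abs_of_nonneg hz0]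
    calc z * |Real.sin a| * |Real.sin θ| ≤ z * 1 * 1 :=
          mul_le_mul (mul_le_mul_of_nonneg_left (Real.abs_sin_le_one a) hz0)
            (Real.abs_sin_le_one θ) (abs_nonneg _) (by positivity)
      _ = z := by ring
  calc |z * Real.sin a * Real.sin θ| * (1 - z) ≤ z * (1 - z) :=
        mul_le_mul_of_nonneg_right h1 (by linarith)
    _ ≤ z * (1 + z * Real.cos a) := mul_le_mul_of_nonneg_left hD hz0

/-! ### The pointwise estimate (2.79) -/

/-- **FS82 (2.79), pointwise form.** For `0 ≤ z < 1` and real `a, θ`,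
`(1 + z cos a) exp(O(a,θ) - γ(z) θ²) ≤ 1 + z cos(a - θ)`: write
`1 + z cos(a-θ) = (1 + z cos a)(1 + x)` with `x = E + O`, use `log(1+x) ≥ x/(1+x) = x - x²/(1+x)`
(`1 + x ≥ (1-z)/(1+z)`), `|x| ≤ z|θ|/(1-z)` (cosine is `1`-Lipschitz) and `E ≥ -zθ²/(2(1-z))`.
[cite: FrohlichSpencerCMP1982, §2.10 (2.79) p. 431] -/
theorem one_add_mul_cos_sub_ge {z : ℝ} (hz0 : 0 ≤ z) (hz1 : z < 1) (a θ : ℝ) :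
    (1 + z * Real.cos a) * Real.exp (oddPart z a θ - gammaFS z * θ ^ 2) ≤
      1 + z * Real.cos (a - θ) := by
  -- `D = 1 + z cos a ∈ [1 - z, 1 + z]`
  have hD : 1 - z ≤ 1 + z * Real.cos a := by nlinarith [Real.neg_one_le_cos a]
  have hD' : 1 + z * Real.cos a ≤ 1 + z := by nlinarith [Real.cos_le_one a]
  have h1z : 0 < 1 - z := by linarith
  have hDpos : 0 < 1 + z * Real.cos a := lt_of_lt_of_le h1z hD
  have hD0 : 1 + z * Real.cos a ≠ 0 := hDpos.ne'
  have hN : 1 - z ≤ 1 + z * Real.cos (a - θ) := by nlinarith [Real.neg_one_le_cos (a - θ)]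
  -- `x = z (cos(a-θ) - cos a)/D`, `1 + x = N/D ≥ (1-z)/(1+z) > 0`
  obtain ⟨x, hxdef⟩ : ∃ x : ℝ, x = z * (Real.cos (a - θ) - Real.cos a) / (1 + z * Real.cos a) :=
    ⟨_, rfl⟩
  have hx1 : 1 + x = (1 + z * Real.cos (a - θ)) / (1 + z * Real.cos a) := by
    rw [hxdef, eq_div_iff hD0]
    field_simp
    ring
  have h1x : (1 - z) / (1 + z) ≤ 1 + x := by
    rw [hx1]
    calc (1 - z) / (1 + z) ≤ (1 - z) / (1 + z * Real.cos a) :=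
          div_le_div_of_nonneg_left h1z.le hDpos hD'
      _ ≤ (1 + z * Real.cos (a - θ)) / (1 + z * Real.cos a) := by gcongr
  have h1xpos : 0 < 1 + x := lt_of_lt_of_le (div_pos h1z (by linarith)) h1x
  -- `|x| ≤ z |θ| / (1 - z)`
  have hxabs : |x| ≤ z * |θ| / (1 - z) := by
    rw [hxdef, abs_div, abs_of_pos hDpos, abs_mul, abs_of_nonneg hz0]
    have hc : |Real.cos (a - θ) - Real.cos a| ≤ |θ| := by
      have := Real.abs_cos_sub_cos_le (a - θ) a
      rwa [show a - θ - a = -θ by ring, abs_neg] at this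
    calc z * |Real.cos (a - θ) - Real.cos a| / (1 + z * Real.cos a)
        ≤ z * |θ| / (1 + z * Real.cos a) := by gcongr
      _ ≤ z * |θ| / (1 - z) := div_le_div_of_nonneg_left (by positivity) h1z hD
  have hx2 : x ^ 2 ≤ z ^ 2 * θ ^ 2 / (1 - z) ^ 2 := by
    have h := pow_le_pow_left₀ (abs_nonneg x) hxabs 2
    rw [sq_abs] at h
    calc x ^ 2 ≤ (z * |θ| / (1 - z)) ^ 2 := h
      _ = z ^ 2 * θ ^ 2 / (1 - z) ^ 2 := by rw [div_pow, mul_pow, sq_abs]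
  -- the logarithmic inequality `x/(1+x) = x - x²/(1+x) ≤ log(1+x)`
  have hlog : x - x ^ 2 / (1 + x) ≤ Real.log (1 + x) := by
    have h := Real.one_sub_inv_le_log_of_pos h1xpos
    have : 1 - (1 + x)⁻¹ = x - x ^ 2 / (1 + x) := by field_simp; ring
    linarith
  -- `x = E + O` with `E = z cos a (cos θ - 1)/D`
  obtain ⟨E, hEdef⟩ : ∃ E : ℝ, E = z * Real.cos a * (Real.cos θ - 1) / (1 + z * Real.cos a) :=
    ⟨_, rfl⟩
  have hxEO : x = E + oddPart z a θ := by
    rw [hxdef, hEdef, oddPart, Real.cos_sub]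
    field_simp
    ring
  -- `E ≥ -z θ²/(2(1-z))`
  have hE : -(z / (2 * (1 - z)) * θ ^ 2) ≤ E := by
    have hcos1 : 0 ≤ 1 - Real.cos θ := by linarith [Real.cos_le_one θ]
    have hcos2 : 1 - Real.cos θ ≤ θ ^ 2 / 2 := by
      linarith [Real.one_sub_sq_div_two_le_cos (x := θ)]
    have habsE : |E| ≤ z * (θ ^ 2 / 2) / (1 - z) := by
      rw [hEdef, abs_div, abs_of_pos hDpos]
      have hnum : |z * Real.cos a * (Real.cos θ - 1)| ≤ z * (θ ^ 2 / 2) := by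
        rw [abs_mul, abs_mul, abs_of_nonneg hz0, show |Real.cos θ - 1| = 1 - Real.cos θ by
          rw [abs_sub_comm]; exact abs_of_nonneg hcos1]
        calc z * |Real.cos a| * (1 - Real.cos θ) ≤ z * 1 * (θ ^ 2 / 2) :=
              mul_le_mul (mul_le_mul_of_nonneg_left (Real.abs_cos_le_one a) hz0) hcos2 hcos1
                (by positivity)
          _ = z * (θ ^ 2 / 2) := by ring
      calc |z * Real.cos a * (Real.cos θ - 1)| / (1 + z * Real.cos a)
          ≤ z * (θ ^ 2 / 2) / (1 + z * Real.cos a) := by gcongr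
        _ ≤ z * (θ ^ 2 / 2) / (1 - z) := div_le_div_of_nonneg_left (by positivity) h1z hD
    have : z * (θ ^ 2 / 2) / (1 - z) = z / (2 * (1 - z)) * θ ^ 2 := by field_simp
    rw [this] at habsE
    linarith [neg_abs_le E]
  -- the remainder `x²/(1+x) ≤ z²(1+z)θ²/(1-z)³`
  have hrem : x ^ 2 / (1 + x) ≤ z ^ 2 * (1 + z) / (1 - z) ^ 3 * θ ^ 2 := by
    have hinv : 1 / (1 + x) ≤ (1 + z) / (1 - z) := by
      rw [div_le_div_iff₀ h1xpos h1z]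
      rw [div_le_iff₀ (by linarith)] at h1x
      linarith
    calc x ^ 2 / (1 + x) = x ^ 2 * (1 / (1 + x)) := by ring
      _ ≤ z ^ 2 * θ ^ 2 / (1 - z) ^ 2 * ((1 + z) / (1 - z)) :=
          mul_le_mul hx2 hinv (by positivity) (by positivity)
      _ = z ^ 2 * (1 + z) / (1 - z) ^ 3 * θ ^ 2 := by
          field_simp
  -- assemble
  have key : oddPart z a θ - gammaFS z * θ ^ 2 ≤ Real.log (1 + x) := by
    have : gammaFS z * θ ^ 2 =
        z / (2 * (1 - z)) * θ ^ 2 + z ^ 2 * (1 + z) / (1 - z) ^ 3 * θ ^ 2 := by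
      unfold gammaFS; ring
    rw [this]
    linarith
  calc (1 + z * Real.cos a) * Real.exp (oddPart z a θ - gammaFS z * θ ^ 2)
      ≤ (1 + z * Real.cos a) * Real.exp (Real.log (1 + x)) :=
        mul_le_mul_of_nonneg_left (Real.exp_le_exp.2 key) hDpos.le
    _ = (1 + z * Real.cos a) * (1 + x) := by rw [Real.exp_log h1xpos]
    _ = 1 + z * Real.cos (a - θ) := by rw [hx1]; field_simp

/-! ### Products over a finite family -/

/-- **FS82 (2.79) for a product**: `(∏ᵢ (1 + zᵢ cos aᵢ)) exp(∑ᵢ Oᵢ - ∑ᵢ γ(zᵢ)θᵢ²) ≤ ∏ᵢ (1 + zᵢ cos(aᵢ - θᵢ))`.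
[cite: FrohlichSpencerCMP1982, §2.10 (2.79) p. 431] -/
theorem prod_one_add_mul_cos_sub_ge {ι : Type*} (s : Finset ι) (z a θ : ι → ℝ)
    (hz : ∀ i ∈ s, 0 ≤ z i ∧ z i < 1) :
    (∏ i ∈ s, (1 + z i * Real.cos (a i))) *
        Real.exp (∑ i ∈ s, oddPart (z i) (a i) (θ i) - ∑ i ∈ s, gammaFS (z i) * θ i ^ 2) ≤
      ∏ i ∈ s, (1 + z i * Real.cos (a i - θ i)) := by
  rw [← Finset.sum_sub_distrib, Real.exp_sum, ← Finset.prod_mul_distrib]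
  refine Finset.prod_le_prod (fun i hi => ?_) fun i hi => one_add_mul_cos_sub_ge (hz i hi).1 (hz i hi).2 _ _
  have : 0 ≤ 1 + z i * Real.cos (a i) := by nlinarith [Real.neg_one_le_cos (a i), (hz i hi).1, (hz i hi).2]
  positivity

/-- The linearised form (`e^y ≥ 1 + y` in place of Jensen's inequality):
`e^{-∑γθ²} (∏ᵢ (1 + zᵢ cos aᵢ)) (1 + ∑ᵢ Oᵢ) ≤ ∏ᵢ (1 + zᵢ cos(aᵢ - θᵢ))`.
[cite: FrohlichSpencerCMP1982, §2.10 (2.79)–(2.80) p. 431] -/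
theorem prod_one_add_mul_cos_sub_ge_linear {ι : Type*} (s : Finset ι) (z a θ : ι → ℝ)
    (hz : ∀ i ∈ s, 0 ≤ z i ∧ z i < 1) :
    Real.exp (-∑ i ∈ s, gammaFS (z i) * θ i ^ 2) * (∏ i ∈ s, (1 + z i * Real.cos (a i))) *
        (1 + ∑ i ∈ s, oddPart (z i) (a i) (θ i)) ≤
      ∏ i ∈ s, (1 + z i * Real.cos (a i - θ i)) := by
  refine le_trans ?_ (prod_one_add_mul_cos_sub_ge s z a θ hz)
  have hP : 0 ≤ ∏ i ∈ s, (1 + z i * Real.cos (a i)) := Finset.prod_nonneg fun i hi => by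
    nlinarith [Real.neg_one_le_cos (a i), (hz i hi).1, (hz i hi).2]
  have h1 : 1 + ∑ i ∈ s, oddPart (z i) (a i) (θ i) ≤ Real.exp (∑ i ∈ s, oddPart (z i) (a i) (θ i)) := by
    linarith [Real.add_one_le_exp (∑ i ∈ s, oddPart (z i) (a i) (θ i))]
  rw [sub_eq_add_neg, Real.exp_add]
  calc Real.exp (-∑ i ∈ s, gammaFS (z i) * θ i ^ 2) * (∏ i ∈ s, (1 + z i * Real.cos (a i))) *
        (1 + ∑ i ∈ s, oddPart (z i) (a i) (θ i))
      ≤ Real.exp (-∑ i ∈ s, gammaFS (z i) * θ i ^ 2) * (∏ i ∈ s, (1 + z i * Real.cos (a i))) *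
        Real.exp (∑ i ∈ s, oddPart (z i) (a i) (θ i)) :=
        mul_le_mul_of_nonneg_left h1 (by positivity)
    _ = _ := by ring

/-! ### The integrated bound (2.79)–(2.80) -/

section Integral

variable {Ω : Type*} [MeasurableSpace Ω]

/-- A measurable involution as a measurable equivalence. [folklore] -/
def involutionEquiv (neg : Ω → Ω) (hneg : Measurable neg) (hinv : Function.Involutive neg) : Ω ≃ᵐ Ω where
  toFun := neg
  invFun := neg
  left_inv := hinv
  right_inv := hinv
  measurable_toFun := hneg
  measurable_invFun := hneg

/-- An odd integrand has integral zero under a measure invariant by the involution. [folklore] -/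
theorem integral_eq_zero_of_odd {μ : Measure Ω} {neg : Ω → Ω} (hneg : Measurable neg)
    (hinv : Function.Involutive neg) (hμ : MeasurePreserving neg μ μ) {f : Ω → ℝ}
    (hf : ∀ ω, f (neg ω) = -f ω) : ∫ ω, f ω ∂μ = 0 := by
  have h := (MeasurePreserving.integral_comp' (f := involutionEquiv neg hneg hinv) hμ f)
  change ∫ ω, f (neg ω) ∂μ = ∫ ω, f ω ∂μ at h
  simp only [hf, integral_neg] at h
  linarith

/-- **FS82 (2.79)–(2.80): the shifted cosine product dominates the unshifted one in the mean, up
to `e^{-∑γθ²}`.** Let `μ` be a finite measure on `Ω` invariant under a measurable involution `neg`,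
and `aᵢ : Ω → ℝ` measurable phases odd under `neg` (`aᵢ ∘ neg = -aᵢ`; e.g. `μ` a centred Gaussian
and `aᵢ = α(ρ̄ᵢ)` linear). Then for activities `0 ≤ zᵢ < 1` and shifts `θᵢ`,
`exp(-∑ᵢ γ(zᵢ) θᵢ²) ∫ ∏ᵢ (1 + zᵢ cos aᵢ) dμ ≤ ∫ ∏ᵢ (1 + zᵢ cos(aᵢ - θᵢ)) dμ`
(the odd first-order term `∑ᵢ Oᵢ` integrates to zero against the even weight).
[cite: FrohlichSpencerCMP1982, §2.10 (2.79)–(2.80) p. 431] -/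
theorem exp_mul_integral_prod_le {ι : Type*} (μ : Measure Ω) [IsFiniteMeasure μ] (s : Finset ι)
    (z θ : ι → ℝ) (hz : ∀ i ∈ s, 0 ≤ z i ∧ z i < 1) (a : ι → Ω → ℝ) (ha : ∀ i, Measurable (a i))
    {neg : Ω → Ω} (hneg : Measurable neg) (hinv : Function.Involutive neg)
    (hμ : MeasurePreserving neg μ μ) (hodd : ∀ i ω, a i (neg ω) = -a i ω) :
    Real.exp (-∑ i ∈ s, gammaFS (z i) * θ i ^ 2) * ∫ ω, ∏ i ∈ s, (1 + z i * Real.cos (a i ω)) ∂μ ≤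
      ∫ ω, ∏ i ∈ s, (1 + z i * Real.cos (a i ω - θ i)) ∂μ := by
  set F : Ω → ℝ := fun ω => ∏ i ∈ s, (1 + z i * Real.cos (a i ω)) with hF
  set G : Ω → ℝ := fun ω => ∑ i ∈ s, oddPart (z i) (a i ω) (θ i) with hG
  set c := Real.exp (-∑ i ∈ s, gammaFS (z i) * θ i ^ 2) with hc
  -- measurability
  have hFm : Measurable F := Finset.measurable_prod _ fun i _ =>
    ((Real.continuous_cos.measurable.comp (ha i)).const_mul _).const_add _
  have hOm : ∀ i, Measurable fun ω => oddPart (z i) (a i ω) (θ i) := fun i => by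
    unfold oddPart
    exact ((((Real.continuous_sin.measurable.comp (ha i)).const_mul _).mul_const _).div
      (((Real.continuous_cos.measurable.comp (ha i)).const_mul _).const_add _))
  have hGm : Measurable G := Finset.measurable_sum _ fun i _ => hOm i
  have hRm : Measurable fun ω => ∏ i ∈ s, (1 + z i * Real.cos (a i ω - θ i)) :=
    Finset.measurable_prod _ fun i _ =>
      ((Real.continuous_cos.measurable.comp ((ha i).sub_const _)).const_mul _).const_add _
  -- bounds
  have hFbd : ∀ ω, |F ω| ≤ 2 ^ s.card := fun ω => by
    rw [hF, Finset.abs_prod]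
    calc ∏ i ∈ s, |1 + z i * Real.cos (a i ω)| ≤ ∏ i ∈ s, (2 : ℝ) :=
          Finset.prod_le_prod (fun i _ => abs_nonneg _) fun i hi => by
            rw [abs_le]; constructor <;>
              nlinarith [Real.neg_one_le_cos (a i ω), Real.cos_le_one (a i ω), (hz i hi).1, (hz i hi).2]
      _ = 2 ^ s.card := by simp
  have hRbd : ∀ ω, |∏ i ∈ s, (1 + z i * Real.cos (a i ω - θ i))| ≤ 2 ^ s.card := fun ω => by
    rw [Finset.abs_prod]
    calc ∏ i ∈ s, |1 + z i * Real.cos (a i ω - θ i)| ≤ ∏ i ∈ s, (2 : ℝ) :=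
          Finset.prod_le_prod (fun i _ => abs_nonneg _) fun i hi => by
            rw [abs_le]; constructor <;>
              nlinarith [Real.neg_one_le_cos (a i ω - θ i), Real.cos_le_one (a i ω - θ i),
                (hz i hi).1, (hz i hi).2]
      _ = 2 ^ s.card := by simp
  have hGbd : ∀ ω, |G ω| ≤ ∑ i ∈ s, z i / (1 - z i) := fun ω =>
    (Finset.abs_sum_le_sum_abs _ _).trans (Finset.sum_le_sum fun i hi =>
      abs_oddPart_le (hz i hi).1 (hz i hi).2 _ _)
  have hFint : Integrable F μ :=
    Integrable.of_bound hFm.aestronglyMeasurable (2 ^ s.card) (Filter.Eventually.of_forall fun ω => by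
      rw [Real.norm_eq_abs]; exact hFbd ω)
  have hRint : Integrable (fun ω => ∏ i ∈ s, (1 + z i * Real.cos (a i ω - θ i))) μ :=
    Integrable.of_bound hRm.aestronglyMeasurable (2 ^ s.card) (Filter.Eventually.of_forall fun ω => by
      rw [Real.norm_eq_abs]; exact hRbd ω)
  have hFGint : Integrable (fun ω => F ω * G ω) μ :=
    Integrable.of_bound (hFm.mul hGm).aestronglyMeasurable (2 ^ s.card * ∑ i ∈ s, z i / (1 - z i))
      (Filter.Eventually.of_forall fun ω => by
        rw [Real.norm_eq_abs, abs_mul]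
        exact mul_le_mul (hFbd ω) (hGbd ω) (abs_nonneg _) (by positivity))
  -- the odd term integrates to zero
  have hFG0 : ∫ ω, F ω * G ω ∂μ = 0 := by
    refine integral_eq_zero_of_odd hneg hinv hμ fun ω => ?_
    have hFe : F (neg ω) = F ω := by
      simp only [hF, hodd, Real.cos_neg]
    have hGo : G (neg ω) = -G ω := by
      simp only [hG, hodd, oddPart_neg, Finset.sum_neg_distrib]
    rw [hFe, hGo, mul_neg]
  -- pointwise bound and integration
  have hpt : ∀ ω, c * F ω * (1 + G ω) ≤ ∏ i ∈ s, (1 + z i * Real.cos (a i ω - θ i)) := fun ω =>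
    prod_one_add_mul_cos_sub_ge_linear s z (fun i => a i ω) θ hz
  have hlin : Integrable (fun ω => c * F ω * (1 + G ω)) μ := by
    have : (fun ω => c * F ω * (1 + G ω)) = fun ω => c * F ω + c * (F ω * G ω) := by
      funext ω; ring
    rw [this]
    exact (hFint.const_mul c).add (hFGint.const_mul c)
  calc c * ∫ ω, F ω ∂μ = ∫ ω, c * F ω * (1 + G ω) ∂μ := by
        have : (fun ω => c * F ω * (1 + G ω)) = fun ω => c * F ω + c * (F ω * G ω) := by
          funext ω; ring
        rw [this, integral_add (hFint.const_mul c) (hFGint.const_mul c), integral_const_mul,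
          integral_const_mul, hFG0, mul_zero, add_zero]
    _ ≤ ∫ ω, ∏ i ∈ s, (1 + z i * Real.cos (a i ω - θ i)) ∂μ :=
        integral_mono hlin hRint hpt

end Integral

end EnsembleExpansion

end Literature.Probability.LatticeModels
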